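import Summits.ValiantsHypothesis.ValiantsHypothesis.Theorems.LacunarySymmetroidMatrixDescartesDoorA26WallBubblingConfluentLimit

/-!
# Wall bubbling for `DoorA26` — TWO WEYL PAIRS: the two-dslope FRAME IDENTITY and the doubly-confluent determinant as a quadratic form

LINE / STUBS.  Crux `Theses.LacunarySymmetroid.DoorA26` (stmt-ValiantsHypothesis-19979; OPEN, typed, never asserted), line
`Cruxes/DoorA26/Lines/wall_bubbling.lean` (val-idea-15), obligation (W) `Stmt.stub_weylFaces`; statement file
`Cruxes/DoorA26/Lines/wall_bubbling_ConfluentDoor.lean` rev 4: the TWO-WEYL-PAIR strata of `Stmt.weylFaces_deepVal` (four distinct values,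
value-generic) and of `Stmt.weylFaces_wall` (one disjoint-type relation (c1)/(c2)/(c3); W1 #14 itemisation).  Seat val-sym-door-p2 g13 (W1 #25).

POSITIONS.  Pair A at `0, 5` (`δ₅ → δ₀`), pair B at `1, 4` (`δ₄ → δ₁`), ordinary letters at `2, 3`.  This file is W2's one-pair frame calculus
(`…ConfluentLimit.frame_sum/frame_det`, `…ConfluentNondeg.confluentDet_eq_quadForm`, door-p1 g14) with TWO divided differences (def-free):

* `frame_sum₂`, `frame_det₂` — THE TWO-DSLOPE FRAME IDENTITY: for letters `U : Fin 6 → Sym₂(ℝ)` and exponents `δ`,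
  `Σ_l e^{δ_l t}U_l = Σ_l c_l(t)•V_l` and `det(Σ_l e^{δ_l t}U_l) = Σ_pq polar(V_p,V_q)·c_p(t)c_q(t)` EXACTLY, with the DOUBLY-CONFLUENT FRAME
  `V = (U₀+U₅, U₁+U₄, U₂, U₃, (δ₄−δ₁)·U₄, (δ₅−δ₀)·U₅)` and coefficient functions `c_l = e^{δ_l t}` (`l ≤ 3`),
  `c₄ = dslope (y ↦ e^{yt}) δ₁ δ₄`, `c₅ = dslope (y ↦ e^{yt}) δ₀ δ₅` (Newton form of both merging pairs; no case distinction in the gaps);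
  `frame_isSymm₂`;
* `doublyConfluentDet_eq_quadForm` — at the limit coefficient functions (`c₄ = t e^{δ₁t}`, `c₅ = t e^{δ₀t}`, written as `dslope … a a`) the same
  quadratic form IS the doubly-confluent determinant `det(e^{δ₀t}(W₀ + tW₅) + e^{δ₁t}(W₁ + tW₄) + Σ_{k<2} e^{δ_{k+2}t} W_{k+2})` whose zeros W1 #24
  `…DoublyConfluentCount` counts (`≤ 19` with multiplicity, unconditionally); `contDiff_doublyConfluentDet`.

USE: W1 #26 `…DoublyConfluentNondeg` (non-degeneracy of the Gram-normalised limit by inertia; wall strata likewise), #27 `…DoublyConfluentLimit`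
(the two-pair clone of W2's `confluentLimit`) and #28 (the door-free window theorem at two Weyl pairs).
Nothing in this file bears on (W)/(M)/(R) themselves, on `DoorA26`, on `MatrixDescartes` (stmt-ValiantsHypothesis-18050) or on `VP ≠ VNP`;
registers unchanged.  `--supports stmt-ValiantsHypothesis-19979 --as helper`.

[folklore] Newton form of Hermite interpolation.  [this work] the two-pair frame bookkeeping.
-/

-- `Summit.ValiantsHypothesis.ValiantsHypothesis.…` repeats a component by the D-0017 layout
-- (single-conjunct summit), which the `dupNamespace` linter flags; the name is mandated.
set_option linter.dupNamespace false

namespace Summit.ValiantsHypothesis.ValiantsHypothesis.Theorems.LacunarySymmetroidMatrixDescartes.WallBubbling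

open Finset Filter Topology Polynomial
open Bubbling (polar polar_comm polar_self det_sum_smul_fin_two)
open scoped BigOperators

/-! ## 1. The two-dslope frame identity -/

/-- **THE TWO-DSLOPE FRAME IDENTITY (letters).**  `Σ_l e^{δ_l t}U_l = Σ_l c_l(t)•V_l` with the doubly-confluent frame `V` (pair A at `0,5`,
pair B at `1,4`) and coefficient functions `c`. [this work] -/
theorem frame_sum₂ (δ : Fin 6 → ℝ) (U : Fin 6 → Matrix (Fin 2) (Fin 2) ℝ) (t : ℝ) :
    ∑ l, Real.exp (δ l * t) • U l
      = ∑ l, (if l = 5 then dslope (fun y : ℝ => Real.exp (y * t)) (δ 0) (δ 5)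
              else if l = 4 then dslope (fun y : ℝ => Real.exp (y * t)) (δ 1) (δ 4) else Real.exp (δ l * t)) •
          (if l = 0 then U 0 + U 5 else if l = 1 then U 1 + U 4 else if l = 4 then (δ 4 - δ 1) • U 4
            else if l = 5 then (δ 5 - δ 0) • U 5 else U l) := by
  simp only [Fin.sum_univ_six]
  have h05 : ((0 : Fin 6) = 5) = False := by decide
  have h04 : ((0 : Fin 6) = 4) = False := by decide
  have h15 : ((1 : Fin 6) = 5) = False := by decide
  have h14 : ((1 : Fin 6) = 4) = False := by decide
  have h10 : ((1 : Fin 6) = 0) = False := by decide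
  have h25 : ((2 : Fin 6) = 5) = False := by decide
  have h24 : ((2 : Fin 6) = 4) = False := by decide
  have h20 : ((2 : Fin 6) = 0) = False := by decide
  have h21 : ((2 : Fin 6) = 1) = False := by decide
  have h35 : ((3 : Fin 6) = 5) = False := by decide
  have h34 : ((3 : Fin 6) = 4) = False := by decide
  have h30 : ((3 : Fin 6) = 0) = False := by decide
  have h31 : ((3 : Fin 6) = 1) = False := by decide
  have h45 : ((4 : Fin 6) = 5) = False := by decide
  have h40 : ((4 : Fin 6) = 0) = False := by decide
  have h41 : ((4 : Fin 6) = 1) = False := by decide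
  have h50 : ((5 : Fin 6) = 0) = False := by decide
  have h51 : ((5 : Fin 6) = 1) = False := by decide
  have h54 : ((5 : Fin 6) = 4) = False := by decide
  simp only [h05, h04, h15, h14, h10, h25, h24, h20, h21, h35, h34, h30, h31, h45, h40, h41, h50, h51, h54, if_true, if_false]
  rw [smul_smul, smul_smul, mul_comm (dslope _ _ _) (δ 4 - δ 1), mul_comm (dslope _ _ _) (δ 5 - δ 0),
    sub_mul_dslope_exp, sub_mul_dslope_exp, sub_smul, sub_smul, smul_add, smul_add]
  abel

/-- **THE TWO-DSLOPE FRAME IDENTITY (determinant).**  The genuine pencil determinant is the quadratic form `Σ_pq polar(V_p,V_q)·c_p c_q` in the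
two-dslope coefficient functions. [this work] -/
theorem frame_det₂ (δ : Fin 6 → ℝ) (U : Fin 6 → Matrix (Fin 2) (Fin 2) ℝ) (t : ℝ) :
    (∑ l, Real.exp (δ l * t) • U l).det
      = ∑ p, ∑ q, polar
            (if p = 0 then U 0 + U 5 else if p = 1 then U 1 + U 4 else if p = 4 then (δ 4 - δ 1) • U 4
              else if p = 5 then (δ 5 - δ 0) • U 5 else U p)
            (if q = 0 then U 0 + U 5 else if q = 1 then U 1 + U 4 else if q = 4 then (δ 4 - δ 1) • U 4
              else if q = 5 then (δ 5 - δ 0) • U 5 else U q) *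
          ((if p = 5 then dslope (fun y : ℝ => Real.exp (y * t)) (δ 0) (δ 5)
              else if p = 4 then dslope (fun y : ℝ => Real.exp (y * t)) (δ 1) (δ 4) else Real.exp (δ p * t)) *
            (if q = 5 then dslope (fun y : ℝ => Real.exp (y * t)) (δ 0) (δ 5)
              else if q = 4 then dslope (fun y : ℝ => Real.exp (y * t)) (δ 1) (δ 4) else Real.exp (δ q * t))) := by
  rw [frame_sum₂, det_sum_smul_fin_two]
  refine Finset.sum_congr rfl fun p _ => Finset.sum_congr rfl fun q _ => ?_
  ring

/-- The doubly-confluent frame of symmetric letters is symmetric. [folklore] -/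
theorem frame_isSymm₂ (δ : Fin 6 → ℝ) (U : Fin 6 → Matrix (Fin 2) (Fin 2) ℝ) (hU : ∀ l, (U l).IsSymm) (l : Fin 6) :
    (if l = 0 then U 0 + U 5 else if l = 1 then U 1 + U 4 else if l = 4 then (δ 4 - δ 1) • U 4
      else if l = 5 then (δ 5 - δ 0) • U 5 else U l).IsSymm := by
  split_ifs
  · exact (hU 0).add (hU 5)
  · exact (hU 1).add (hU 4)
  · exact (hU 4).smul _
  · exact (hU 5).smul _
  · exact hU l

/-! ## 2. The doubly-confluent determinant as the same quadratic form -/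

/-- **The doubly-confluent determinant as the quadratic form at the limit coefficient functions** (`c₅ = dslope … δ₀ δ₀ = t e^{δ₀t}`,
`c₄ = dslope … δ₁ δ₁ = t e^{δ₁t}`): for `W : Fin 6 → Sym₂(ℝ)` (`τ = W₀`, `T = W₅`, `τ′ = W₁`, `T′ = W₄`, ordinary letters `W₂, W₃` at the positions
`k.succ.succ.castSucc.castSucc`, `k : Fin 2`). [this work] -/
theorem doublyConfluentDet_eq_quadForm (δ0 : Fin 6 → ℝ) (W : Fin 6 → Matrix (Fin 2) (Fin 2) ℝ) (t : ℝ) :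
    ((Real.exp (δ0 0 * t)) • (W 0 + t • W 5) + (Real.exp (δ0 1 * t)) • (W 1 + t • W 4)
        + ∑ k : Fin 2, (Real.exp (δ0 k.succ.succ.castSucc.castSucc * t)) • W k.succ.succ.castSucc.castSucc).det
      = ∑ p, ∑ q, polar (W p) (W q) *
          ((if p = 5 then dslope (fun y : ℝ => Real.exp (y * t)) (δ0 0) (δ0 0)
              else if p = 4 then dslope (fun y : ℝ => Real.exp (y * t)) (δ0 1) (δ0 1) else Real.exp (δ0 p * t)) *
            (if q = 5 then dslope (fun y : ℝ => Real.exp (y * t)) (δ0 0) (δ0 0)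
              else if q = 4 then dslope (fun y : ℝ => Real.exp (y * t)) (δ0 1) (δ0 1) else Real.exp (δ0 q * t))) := by
  have hsum : (Real.exp (δ0 0 * t)) • (W 0 + t • W 5) + (Real.exp (δ0 1 * t)) • (W 1 + t • W 4)
        + ∑ k : Fin 2, (Real.exp (δ0 k.succ.succ.castSucc.castSucc * t)) • W k.succ.succ.castSucc.castSucc
      = ∑ l, (if l = 5 then dslope (fun y : ℝ => Real.exp (y * t)) (δ0 0) (δ0 0)
              else if l = 4 then dslope (fun y : ℝ => Real.exp (y * t)) (δ0 1) (δ0 1) else Real.exp (δ0 l * t)) • W l := by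
    simp only [Fin.sum_univ_six, Fin.sum_univ_two]
    have h05 : ((0 : Fin 6) = 5) = False := by decide
    have h04 : ((0 : Fin 6) = 4) = False := by decide
    have h15 : ((1 : Fin 6) = 5) = False := by decide
    have h14 : ((1 : Fin 6) = 4) = False := by decide
    have h25 : ((2 : Fin 6) = 5) = False := by decide
    have h24 : ((2 : Fin 6) = 4) = False := by decide
    have h35 : ((3 : Fin 6) = 5) = False := by decide
    have h34 : ((3 : Fin 6) = 4) = False := by decide
    have h45 : ((4 : Fin 6) = 5) = False := by decide
    have e2 : ((0 : Fin 2).succ.succ.castSucc.castSucc : Fin 6) = 2 := by decide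
    have e3 : ((1 : Fin 2).succ.succ.castSucc.castSucc : Fin 6) = 3 := by decide
    simp only [e2, e3, h05, h04, h15, h14, h25, h24, h35, h34, h45, if_true, if_false, dslope_exp_same, smul_add, smul_smul]
    rw [mul_comm (Real.exp (δ0 0 * t)) t, mul_comm (Real.exp (δ0 1 * t)) t]
    abel
  rw [hsum, det_sum_smul_fin_two]
  refine Finset.sum_congr rfl fun p _ => Finset.sum_congr rfl fun q _ => ?_
  ring

/-- The doubly-confluent determinant is smooth in `t`. [folklore] -/
theorem contDiff_doublyConfluentDet (n : ℕ) (δ0 : Fin 6 → ℝ) (W : Fin 6 → Matrix (Fin 2) (Fin 2) ℝ) :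
    ContDiff ℝ n (fun t : ℝ => ((Real.exp (δ0 0 * t)) • (W 0 + t • W 5) + (Real.exp (δ0 1 * t)) • (W 1 + t • W 4)
        + ∑ k : Fin 2, (Real.exp (δ0 k.succ.succ.castSucc.castSucc * t)) • W k.succ.succ.castSucc.castSucc).det) := by
  have h : (fun t : ℝ => ((Real.exp (δ0 0 * t)) • (W 0 + t • W 5) + (Real.exp (δ0 1 * t)) • (W 1 + t • W 4)
        + ∑ k : Fin 2, (Real.exp (δ0 k.succ.succ.castSucc.castSucc * t)) • W k.succ.succ.castSucc.castSucc).det)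
      = fun t => ∑ p, ∑ q, polar (W p) (W q) *
          ((if p = 5 then dslope (fun y : ℝ => Real.exp (y * t)) (δ0 0) (δ0 0)
              else if p = 4 then dslope (fun y : ℝ => Real.exp (y * t)) (δ0 1) (δ0 1) else Real.exp (δ0 p * t)) *
            (if q = 5 then dslope (fun y : ℝ => Real.exp (y * t)) (δ0 0) (δ0 0)
              else if q = 4 then dslope (fun y : ℝ => Real.exp (y * t)) (δ0 1) (δ0 1) else Real.exp (δ0 q * t))) := by
    funext t; exact doublyConfluentDet_eq_quadForm δ0 W t
  rw [h]
  have hc : ∀ p : Fin 6, ContDiff ℝ n (fun t : ℝ => (if p = 5 then dslope (fun y : ℝ => Real.exp (y * t)) (δ0 0) (δ0 0)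
      else if p = 4 then dslope (fun y : ℝ => Real.exp (y * t)) (δ0 1) (δ0 1) else Real.exp (δ0 p * t))) := by
    intro p
    by_cases hp5 : p = 5
    · simp only [hp5, if_true]; exact contDiff_dslope_exp _ _ n
    · by_cases hp4 : p = 4
      · simp only [hp4, if_true]
        have h45 : ((4 : Fin 6) = 5) = False := by decide
        simp only [h45, if_false]
        exact contDiff_dslope_exp _ _ n
      · simp only [hp5, hp4, if_false]; exact contDiff_exp_const_mul' _ n
  refine ContDiff.sum fun p _ => ContDiff.sum fun q _ => ?_
  exact contDiff_const.mul ((hc p).mul (hc q))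

end Summit.ValiantsHypothesis.ValiantsHypothesis.Theorems.LacunarySymmetroidMatrixDescartes.WallBubbling
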